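import Summits.RiemannHypothesis.RiemannHypothesis.Theorems.HandoffLadderTheoremRungs
import Summits.RiemannHypothesis.RiemannHypothesis.Theorems.WeilFormatCDataA1RungCB
import Summits.RiemannHypothesis.RiemannHypothesis.Theorems.HandoffWallSequence
import Summits.RiemannHypothesis.RiemannHypothesis.Theorems.HandoffUpperClauses
import Literature.NumberTheory.ConnesConsani2021.WeilPropertyP
import Summits.RiemannHypothesis.RiemannHypothesis.Theorems.PfPersistenceM2ShortWindows
import HarnessLib

/-!
# HANDOFF — the `a = 1` RUNG IN THE HANDOFF LEDGER: `H(5)` is a theorem, `5` moves the wall, Conj. 4.1 holds at every `q ≤ 7` (cell rh-explicit, TRACK «HANDOFF», seat theory-1, file XXII)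

HONEST FRAMING. Nothing here bears on the truth of RH. This file is RH-free bookkeeping on tree theorems: it reads
the format-C lane's kernel rung **`WeilFormatCData.A1.weilPositivityOn_one : WeilPositivityOn 1`** (weil-2 g15,
`WeilFormatCDataA1RungCB.lean`, p393632 — Weil's functional is non-negative on every test function supported in
`[-1, 1]`, a certified-data theorem with standard axioms) in the coordinates of the handoff decomposition
`RH ↔ Base ∧ ∀ q prime, H(q)` (`HandoffDecomposition.handoffTarget_holds`).  Since `(log 7)/2 = 0.97296… ≤ 1`
(`7 ≤ e²`), the rung PAYS the next window: theory-2's conditional §3 of `HandoffLadderTheoremRungs.lean`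
(`forall_handoffH_of_weilPositivityOn_one`, `riemannHypothesis_iff_forall_ge_seven_handoffStep_of_weilPositivityOn_one`,
written when `WeilPositivityOn 1` was «NOT in the tree») is DISCHARGED, and the THEOREM ladder of HANDOFF-STATEMENT
§H / PNT-T2 moves from `H(2), H(3)` to `H(2), H(3), H(5)`:

* §1 `weilPositivityOn_log_seven_half` (the rung `IH(7) = WeilPositivityOn ((log 7)/2)`), **`handoffH_five : H(5)`**
  (previously CERTIFIED TWO-ENGINE, now KERNEL), `H(q)` and `H′(q)` for every prime `q < 7`; the failed increment, if RH is
  false, sits at a prime `q ≥ 7` (`seven_le_of_not_handoffStep`); **`RH ↔ ∀ primes q ≥ 7, H′(q)`** and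
  **`RH ↔ ∀ primes q ≥ 7, H(q)`**; the Weil onset, if any, is `≥ 1` (`one_le_of_isWeilOnset`); the window bottom
  `ε(b) ≥ 0` for every `0 < b ≤ 1`.
* §2 the aggregate objects at the new theorem rung: `δ*(7) ≥ 0`, i.e. **`(log 7)/2 ≤ a*({2,3,5})`**; `{2,3,5}`-positivity
  at `(log 7)/2`; `D_7((log 7)/2) ≤ 0`; `N(5)`; the loads `r(5) ≤ 1 − ε((log 7)/2)/cap(5) ≤ 1`; and, by locality on `C(1)`
  (only the prime powers `n ≤ 7 < e²` are visible there), **`1 ≤ a*({p < N})` for EVERY `N ≥ 8`** — every semi-local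
  wall from `{2,3,5,7}` on is at least `1`, unconditionally (`one_le_wall_of_ge_eight`).
* §3 **`5` MOVES THE WALL, unconditionally**: `a*({2,3}) < a*({2,3,5})` (`wall_five_lt_wall_seven`: the kernel upper
  clause `UC(5)` of theory-2's `HandoffUpperClauses` + the new rung `H(5)`), hence **THREE primes move the wall**:
  `a*(∅) < a*({2}) < a*({2,3}) < a*({2,3,5})` (`three_primes_move_the_wall`) — theory-2's
  `HandoffWallMotionFive.three_primes_move_the_wall_of_sector_energies_83` asked for the two GroundBarta `83/100` sector
  blocks; the `a = 1` rung supersedes that hypothesis (any full-form rung in `(163/200, (log 7)/2]`-or-above does).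
  «RH ⟺ infinitely many primes move the wall» (`riemannHypothesis_iff_wall_moves_io`) is untouched: three is not
  infinitely many.  With cc-s2-4's kernel upper wall the third wall is pinned two-sidedly in the kernel:
  `(log 7)/2 ≤ a*({2,3,5}) ≤ 197/200`, i.e. `0 ≤ δ*(7) ≤ 0.01204…` (`wall_seven_mem_Icc`, `wallOffset_seven_mem_Icc`).
* §4 Connes's property `P(n)` and the content of Connes–Consani's Conjecture 4.1 at EVERY `n ≤ 7`, as THEOREMS
  (`weilPropertyP_of_le_seven`, `cc41_of_le_seven`; print: `n = 2`; the tree had `n ≤ 5`).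
* §5 the index ledger (file XIX): no negative even direction at level `1`, nor at `(log 7)/2`.

READING for the track's tables (LOGIC-CARD 2″/3′, PNT-T2 column (A), PNT-T3 T3.5): at KERNEL grade the H-ladder now
reads THEOREM `q = 2, 3, 5`; the increment form of RH is priced at `q₀ = 7`; under `¬RH` the failing prime is `≥ 7` and
Yoshida's onset `a₀ ≥ 1`, so the frozen wall value is `≥ 1`; «2, 3 AND 5 move the wall» is a THEOREM.  None of this is
evidence for or against RH: a finite initial segment of an RH-equivalent family of clauses, certified in the kernel.

References: E. Bombieri, Rend. Mat. Acc. Lincei (9) 11 (2000) 183–233, Thm. 2, §4 (`Bombieri2000Weil`); H. Yoshida,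
Adv. Stud. Pure Math. 21 (1992) 281–325, Thm. 1 (p. 310), Prop. 6 (p. 320) (`Yoshida1992HermitianForms`); A. Connes,
C. Consani, J. Operator Theory 85 (2021) = arXiv:1910.14368, Conj. 4.1 (p. 18) (`ConnesConsani2021ScalingHamiltonian`);
A. Connes, letter 2026, §4.1 (arXiv pp. 20–21) (`Connes2026Letter`: P(n)); A. Connes, C. Consani, Enseign. Math. 69 (2023) §2.1.2
(`ConnesConsani2023`: only the primes `p < λ²` enter); this track: HANDOFF-STATEMENT §B, §H, §J.16/§J.29, PNT-T3 §T3.5.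
-/

set_option linter.dupNamespace false  -- the mandated namespace repeats `RiemannHypothesis`

noncomputable section

open Set Literature.NumberTheory.LFunctions Literature.NumberTheory.ConnesConsani2021
open Summit.RiemannHypothesis.RiemannHypothesis.Theorems
open Summit.RiemannHypothesis.RiemannHypothesis.Theorems.Handoff (ConsecutivePrimes)
open Summit.RiemannHypothesis.RiemannHypothesis.Theorems.HandoffDecomposition
open Summit.RiemannHypothesis.RiemannHypothesis.Theorems.HandoffSemilocalEnergy
open Summit.RiemannHypothesis.RiemannHypothesis.Theorems.HandoffLoadCeiling
open Summit.RiemannHypothesis.RiemannHypothesis.Theorems.HandoffLoadCriterion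
open Summit.RiemannHypothesis.RiemannHypothesis.Theorems.HandoffMarginLaw
open Summit.RiemannHypothesis.RiemannHypothesis.Theorems.HandoffLadderRungs
open Summit.RiemannHypothesis.RiemannHypothesis.Theorems.HandoffLadderTheoremRungs
open Summit.RiemannHypothesis.RiemannHypothesis.Theorems.HandoffUpperClauses
open Summit.RiemannHypothesis.RiemannHypothesis.Theorems.MotivicDoor.SemilocalThreshold
open Summit.RiemannHypothesis.RiemannHypothesis.Theorems.WeilFormatCData.A1 (weilPositivityOn_one)
open Summit.RiemannHypothesis.RiemannHypothesis.Theorems.PfPersistenceM2NegIndex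
  (EvenNegIndexAtLeast not_evenNegIndexAtLeast_succ_of_weilPositivityOn)

namespace Summit.RiemannHypothesis.RiemannHypothesis.Theorems.HandoffLadderRungOne

variable {q n N : ℕ} {a₀ b : ℝ}

/-! ## §1  The rung `WeilPositivityOn 1` in handoff coordinates: `H(5)` is a theorem -/

/-- `(log 7)/2 ≤ 1` (`7 ≤ e²`, theory-2's `seven_le_exp_two`). [folklore] -/
theorem log_seven_half_le_one : Real.log 7 / 2 ≤ 1 := by
  have h : Real.log ((7 : ℕ) : ℝ) / 2 ≤ 1 := log_half_le_of_le_exp (by norm_num) seven_le_exp_two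
  exact_mod_cast h

/-- **The rung `IH(7) = WeilPositivityOn ((log 7)/2)`** — Weil positivity at the LEFT end of the window of `7`, from the
format-C kernel rung `WeilPositivityOn 1` (weil-2, `WeilFormatCData.A1.weilPositivityOn_one`) by monotonicity in the window.
[cite: Bombieri2000Weil, §4; tree rung] -/
theorem weilPositivityOn_log_seven_half : WeilPositivityOn (Real.log 7 / 2) :=
  weilPositivityOn_one.mono log_seven_half_le_one

/-- The window bottom is non-negative up to bandwidth `1`: `0 ≤ ε(b)` for every `0 < b ≤ 1`. [cite: Bombieri2000Weil, §4 (ground energy); tree rung] -/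
theorem weilGroundEnergy_nonneg_of_le_one (hb0 : 0 < b) (hb : b ≤ 1) : 0 ≤ weilGroundEnergy b :=
  (weilGroundEnergy_nonneg_iff_holds hb0).2 (weilPositivityOn_one.mono hb)

/-- **`H(5)` IS A THEOREM**: on the window `[(log 5)/2, (log 7)/2]` the deficit of the `{2,3}`-form never exceeds the
contribution of `5` — i.e. `WeilPositivityOn ((log 7)/2)` (`handoffH_five_iff`), paid by the `a = 1` rung.  (Previously a
CERTIFIED TWO-ENGINE data object of the cell's ladder, HANDOFF-STATEMENT §H.16; now kernel.)
[cite: Yoshida1992HermitianForms, Prop. 6 (p. 320) (window form); tree rung] -/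
theorem handoffH_five : HandoffH 5 := handoffH_five_iff.2 weilPositivityOn_log_seven_half

/-- Two-argument form: `H(5, 7)`. [folklore] -/
theorem handoffH_five_seven : Handoff.HandoffH 5 7 := by
  have h := handoffH_five
  unfold HandoffDecomposition.HandoffH at h
  rwa [nextPrime_five] at h

/-- `H(q)` for every prime `q < 7` (`H(2)`, `H(3)`, `H(5)`), unconditionally — theory-2's
`forall_handoffH_of_weilPositivityOn_one` DISCHARGED. [folklore] -/
theorem forall_handoffH_of_lt_seven : ∀ q : ℕ, q.Prime → q < 7 → HandoffH q :=
  forall_handoffH_of_weilPositivityOn_one weilPositivityOn_one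

/-- The increment `H′(5)` holds (trivially, from `H(5)`). [folklore] -/
theorem handoffStep_five : HandoffStep 5 := fun _ ↦ handoffH_five

/-- The increments `H′(q)` hold for every prime `q < 7`. [folklore] -/
theorem forall_handoffStep_of_lt_seven : ∀ q : ℕ, q.Prime → q < 7 → HandoffStep q :=
  fun q hq hq7 _ ↦ forall_handoffH_of_lt_seven q hq hq7

/-- **The failed increment, if any, sits at a prime `q ≥ 7`** (theory-1's `eq_of_not_handoffStep`: at most one increment
fails; theory-2's `five_le_of_not_handoffStep` sharpened by one window). [this track; tree rung] -/
theorem seven_le_of_not_handoffStep (hq : q.Prime) (h : ¬ HandoffStep q) : 7 ≤ q := by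
  by_contra hlt
  exact h (forall_handoffStep_of_lt_seven q hq (not_le.1 hlt))

/-- **`RH ↔ ∀ primes q ≥ 7, H′(q)`** — the increment form of the handoff criterion with its first THREE steps discharged:
the tail of increments from `q₀` is worth exactly «rung at `q₀` ⟹ RH» (`forall_ge_handoffStep_iff`), and the rung at
`q₀ = 7` is now a tree theorem.  (It does not bring RH nearer: the conjunction of the remaining increments is RH.)
[cite: Bombieri2000Weil, Thm. 2; this track] -/
theorem riemannHypothesis_iff_forall_ge_seven_handoffStep :
    Summit.RiemannHypothesis ↔ ∀ q : ℕ, q.Prime → 7 ≤ q → HandoffStep q :=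
  riemannHypothesis_iff_forall_ge_seven_handoffStep_of_weilPositivityOn_one weilPositivityOn_one

/-- **`RH ↔ ∀ primes q ≥ 7, H(q)`** (`H(2)`, `H(3)`, `H(5)` are theorems). [cite: Bombieri2000Weil, Thm. 2; this track] -/
theorem riemannHypothesis_iff_forall_ge_seven_handoffH :
    Summit.RiemannHypothesis ↔ ∀ q : ℕ, q.Prime → 7 ≤ q → HandoffH q := by
  rw [riemannHypothesis_iff_forall_handoffH]
  refine ⟨fun h q hq _ ↦ h q hq, fun h q hq ↦ ?_⟩
  by_cases h7 : 7 ≤ q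
  · exact h q hq h7
  · exact forall_handoffH_of_lt_seven q hq (not_le.1 h7)

/-- `¬RH ↔` some prime `q ≥ 7` has `¬H(q)` (the first candidate window is now `[(log 7)/2, (log 11)/2]`). [this track] -/
theorem not_riemannHypothesis_iff_exists_ge_seven_not_handoffH :
    ¬ Summit.RiemannHypothesis ↔ ∃ q : ℕ, q.Prime ∧ 7 ≤ q ∧ ¬ HandoffH q := by
  rw [riemannHypothesis_iff_forall_ge_seven_handoffH]
  push Not
  rfl

/-- **The Weil onset (solo-informed T56; it exists iff RH fails with a sign change of `ε`), if any, is at least `1`** —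
hence under `¬RH` the frozen wall value `a₀` is `≥ 1`. [this track; T56; tree rung] -/
theorem one_le_of_isWeilOnset (h : IsWeilOnset a₀) : 1 ≤ a₀ :=
  h.le_of_weilPositivityOn weilPositivityOn_one

/-! ## §2  The aggregate objects at the new theorem rung (RH-free quantities, now with a THEOREM sign) -/

/-- **`δ*(7) ≥ 0`**: the wall of the `{2,3,5}`-form is at or beyond `(log 7)/2` (from `H(5)`; DATA, the cell's certified
kernel walls: `a*({2,3,5}) ≤ 393/400`, so `0 ≤ δ*(7) ≤ 0.0096` — the upper half is cc-s2-4's, not proved here).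
[cite: Yoshida1992HermitianForms, Prop. 6 (p. 320); tree rung] -/
theorem wallOffset_seven_nonneg : 0 ≤ wallOffset 7 := by
  have h := (handoffH_iff_wallOffset_nonneg (show Nat.Prime 5 by norm_num)).1 handoffH_five
  rwa [nextPrime_five] at h

/-- Threshold form: **`(log 7)/2 ≤ a*({p < 7})`** (`a* = weilSemilocalThreshold`, an honest maximum). [cite: Yoshida1992HermitianForms, Prop. 6 (p. 320)] -/
theorem log_seven_half_le_weilSemilocalThreshold :
    Real.log 7 / 2 ≤ weilSemilocalThreshold (Nat.primesBelow 7) := by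
  have h := (handoffH_iff_wallOffset (show Nat.Prime 5 by norm_num)).1 handoffH_five
  rw [nextPrime_five] at h
  exact_mod_cast h

/-- **The `{2,3,5}`-semilocal Weil form is non-negative on every test function supported in `[−(log 7)/2, (log 7)/2]`.**
[cite: ConnesConsani2023, §2.1.2 (semilocal form; only prime powers `n ≤ λ²` enter); tree rung] -/
theorem weilSemilocalPositivityOn_two_three_five_log_seven_half :
    WeilSemilocalPositivityOn ({2, 3, 5} : Finset ℕ) (Real.log 7 / 2) := by
  have h := (handoffH_iff_weilSemilocalPositivityOn (show Nat.Prime 5 by norm_num)).1 handoffH_five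
  rw [nextPrime_five, HandoffUpperClauses.primesBelow_seven] at h
  exact_mod_cast h

/-- **`D_7((log 7)/2) ≤ 0`**: the `{2,3,5}`-form has no aggregate deficit at the end of the window of `5`. [this track] -/
theorem aggregateDeficit_seven_log_seven_half_nonpos : aggregateDeficit 7 (Real.log 7 / 2) ≤ 0 := by
  have h := (handoffH_iff_aggregateDeficit_nonpos consecutivePrimes_five_seven).1 handoffH_five_seven
  exact_mod_cast h

/-- **`D_5(b) ≤ cap(5) − ε(b)` with `0 ≤ ε(b)` on the whole window `b ∈ [(log 5)/2, (log 7)/2]`** — the aggregate necessary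
condition `N(5)` WITH its margin, unconditionally. [this track] -/
theorem aggregateDeficit_five_le (hb : b ∈ Icc (Real.log 5 / 2) (Real.log 7 / 2)) :
    aggregateDeficit 5 b ≤ Real.log 5 / Real.sqrt 5 - weilGroundEnergy b ∧ 0 ≤ weilGroundEnergy b := by
  have h := aggregateDeficit_le_cap_sub_of_handoffH (b := b) consecutivePrimes_five_seven handoffH_five_seven
  exact h (by exact_mod_cast hb)

/-- **`r(5) ≤ 1 − ε((log 7)/2)/cap(5)`** (conj-1's load at the third window; the margin term is a THEOREM sign, its size
DATA). [this track] -/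
theorem handoffLoad_five_seven_le :
    handoffLoad 5 7 ≤ 1 - weilGroundEnergy (Real.log 7 / 2) / (Real.log 5 / Real.sqrt 5) := by
  have h := handoffLoad_le_one_sub_of_handoffH consecutivePrimes_five_seven handoffH_five_seven
  exact_mod_cast h

/-- **`r(5) ≤ 1`** unconditionally (`RH ↔ ∀ q, r(q) ≤ 1`, `HandoffLoadCriterion`; `r(2), r(3) ≤ 1` were theory-2's). [this track] -/
theorem handoffLoad_five_seven_le_one : handoffLoad 5 7 ≤ 1 :=
  handoffLoad_le_one_of_handoffH consecutivePrimes_five_seven handoffH_five_seven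

/-- **`N(5)`**: `deficit_5(g) ≤ cap(5)‖g‖₂²` for every Weil test function on the window end (theory-1's `HandoffNormBound 5`). [this track] -/
theorem handoffNormBound_five : HandoffNormBound 5 := handoffH_five.normBound (by norm_num)

/-- In the load currency: `RH ↔ r(q) ≤ 1` for every prime `q ≥ 7` (`r(2), r(3), r(5) ≤ 1` are theorems; `←` goes through
«`r ≤ 1` for infinitely many primes ⟹ RH», not prime by prime). [this track] -/
theorem riemannHypothesis_iff_forall_ge_seven_handoffLoad_le_one :
    Summit.RiemannHypothesis ↔ ∀ q : ℕ, q.Prime → 7 ≤ q → handoffLoad q (nextPrime q) ≤ 1 := by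
  constructor
  · intro hRH q hq _
    exact riemannHypothesis_iff_forall_handoffLoad_le_one.1 hRH q hq
  · intro h
    refine riemannHypothesis_of_frequently_handoffLoad_le_one fun M ↦ ?_
    obtain ⟨q, hMq, hq⟩ := Nat.exists_infinite_primes (max M 7)
    exact ⟨q, (le_max_left _ _).trans hMq, hq, h q hq ((le_max_right _ _).trans hMq)⟩

/-- `1 ≤ (log 8)/2` (kernel arithmetic: `e² = 2.71828…² ≤ 8`; the inequality `exp 2 ≤ 8` is a `have`, the tree holds it
under several names already). [folklore] -/
theorem one_le_log_eight_half : (1 : ℝ) ≤ Real.log 8 / 2 := by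
  have he : Real.exp 2 ≤ 8 := by
    have h1 := Real.exp_one_lt_d9
    have h0 := (Real.exp_pos 1).le
    have h2 : Real.exp 2 = Real.exp 1 * Real.exp 1 := by rw [← Real.exp_add]; norm_num
    rw [h2]
    nlinarith
  have : (2 : ℝ) ≤ Real.log 8 := (Real.le_log_iff_exp_le (by norm_num)).2 he
  linarith

/-- **Locality on `C(1)`**: for EVERY `N ≥ 8` the `{p < N}`-semilocal form is non-negative on every test function supported
in `[−1, 1]` — on `C(1)` only the prime powers `n ≤ e² < 8` are visible, and their primes are `< N`, so there the
`{p < N}`-form IS Weil's form, which is non-negative by the `a = 1` rung. [cite: ConnesConsani2023, §2.1.2 (only the primes p < λ² enter QW_λ); tree rung] -/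
theorem weilSemilocalPositivityOn_one_of_ge_eight (hN : 8 ≤ N) :
    WeilSemilocalPositivityOn (Nat.primesBelow N) 1 := by
  intro g hg hsupp
  have h8 : (1 : ℝ) ≤ Real.log (((7 : ℕ) : ℝ) + 1) / 2 := by norm_num; exact one_le_log_eight_half
  have hsupp' : tsupport g ⊆ Icc (-(Real.log (((7 : ℕ) : ℝ) + 1) / 2)) (Real.log (((7 : ℕ) : ℝ) + 1) / 2) :=
    hsupp.trans (Icc_subset_Icc (by linarith) h8)
  rw [weilSemilocalQuadratic_eq_weilQuadratic_of_forall hg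
    (primeFactors_subset_primesBelow_of_lt (lt_of_lt_of_le (by norm_num : 7 < 8) hN)) hsupp']
  exact weilPositivityOn_one g hg hsupp

/-- **`1 ≤ a*({p < N})` for every `N ≥ 8`**: every semi-local wall from `S = {2,3,5,7}` on is at least `1`, unconditionally
(so `δ*(N) ≥ 1 − (log N)/2`; at `N = 11`: `δ*(11) ≥ −0.199`, the sign of `δ*(11)` — `H(7)` — is NOT claimed).
[cite: Yoshida1992HermitianForms, Prop. 6 (p. 320) (thresholds with primes restricted to S); tree rung] -/
theorem one_le_wall_of_ge_eight (hN : 8 ≤ N) : (1 : ℝ) ≤ weilSemilocalThreshold (Nat.primesBelow N) :=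
  le_weilSemilocalThreshold (weilSemilocalPositivityOn_one_of_ge_eight hN)

/-- Offset form: `1 − (log N)/2 ≤ δ*(N)` for every `N ≥ 8`. [this track] -/
theorem one_sub_log_half_le_wallOffset (hN : 8 ≤ N) : 1 - Real.log N / 2 ≤ wallOffset N := by
  unfold wallOffset
  linarith [one_le_wall_of_ge_eight hN]

/-! ## §3  `5` moves the wall — unconditionally; three primes move the wall -/

/-- **`5` MOVES THE WALL**: `a*({2,3}) < a*({2,3,5})` — the kernel upper clause `UC(5)` (`a*({p<5}) < (log 7)/2`,
theory-2's `weilSemilocalThreshold_primesBelow_five_lt` on cc-s2-4's kernel wall certificate) and the new THEOREM rung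
`H(5)` (`(log 7)/2 ≤ a*({p<7})`), through theory-1's XII `wall_lt_wall_nextPrime_of_upperClause`.  theory-2's
`HandoffWallMotionFive` obtained the same from the two GroundBarta `83/100` sector blocks as hypotheses; the `a = 1` rung
supersedes them. [cite: Yoshida1992HermitianForms, Prop. 6 (p. 320); kernel wall certificate and rung (tree)] -/
theorem wall_five_lt_wall_seven :
    weilSemilocalThreshold (Nat.primesBelow 5) < weilSemilocalThreshold (Nat.primesBelow 7) := by
  have hUC : weilSemilocalThreshold (Nat.primesBelow 5) < Real.log (nextPrime 5) / 2 := by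
    rw [nextPrime_five]
    exact_mod_cast weilSemilocalThreshold_primesBelow_five_lt
  have h := wall_lt_wall_nextPrime_of_upperClause (show Nat.Prime 5 by norm_num) hUC handoffH_five
  rwa [nextPrime_five] at h

/-- **THREE primes move the wall, unconditionally (kernel)**: `a*(∅) < a*({2}) < a*({2,3}) < a*({2,3,5})` — theory-1's
`two_primes_move_the_wall` (XIII §3, re-derived inline from XII + theory-2's `HandoffUpperClauses`) plus
`wall_five_lt_wall_seven`.  «RH ⟺ infinitely many primes move the wall» (XIII `riemannHypothesis_iff_wall_moves_io`) is
untouched. [this track: HANDOFF-STATEMENT §B.5/§J.16, PNT-T3 §T3.5] -/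
theorem three_primes_move_the_wall :
    weilSemilocalThreshold (Nat.primesBelow 2) < weilSemilocalThreshold (Nat.primesBelow 3) ∧
      weilSemilocalThreshold (Nat.primesBelow 3) < weilSemilocalThreshold (Nat.primesBelow 5) ∧
        weilSemilocalThreshold (Nat.primesBelow 5) < weilSemilocalThreshold (Nat.primesBelow 7) := by
  -- the first two steps are theory-1's XIII §3 (`wall_two_lt_wall_three`, `wall_three_lt_wall_five`), re-derived here from
  -- XII + theory-2's upper clauses so that this file does not import XIII (whose hub olean predates its §5 append)
  have h2 : weilSemilocalThreshold (Nat.primesBelow 2) < weilSemilocalThreshold (Nat.primesBelow 3) := by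
    have h := wall_lt_wall_nextPrime_of_upperClause Nat.prime_two
      (by rw [nextPrime_two]; exact_mod_cast weilSemilocalThreshold_primesBelow_two_lt) handoffH_two
    rwa [nextPrime_two] at h
  have h3 : weilSemilocalThreshold (Nat.primesBelow 3) < weilSemilocalThreshold (Nat.primesBelow 5) := by
    have h := wall_lt_wall_nextPrime_of_upperClause Nat.prime_three
      (by rw [nextPrime_three]; exact_mod_cast weilSemilocalThreshold_primesBelow_three_lt) handoffH_three
    rwa [nextPrime_three] at h
  exact ⟨h2, h3, wall_five_lt_wall_seven⟩

/-- Counting form: at least three distinct primes `p` with `a*({ℓ < p}) < a*({ℓ ≤ p})` — witnesses `2`, `3`, `5`. [this track] -/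
theorem exists_three_primes_move_the_wall :
    ∃ p q r : ℕ, p.Prime ∧ q.Prime ∧ r.Prime ∧ p < q ∧ q < r ∧
      weilSemilocalThreshold (Nat.primesBelow p) < weilSemilocalThreshold (Nat.primesBelow (nextPrime p)) ∧
      weilSemilocalThreshold (Nat.primesBelow q) < weilSemilocalThreshold (Nat.primesBelow (nextPrime q)) ∧
      weilSemilocalThreshold (Nat.primesBelow r) < weilSemilocalThreshold (Nat.primesBelow (nextPrime r)) := by
  obtain ⟨h2, h3, h5⟩ := three_primes_move_the_wall
  refine ⟨2, 3, 5, Nat.prime_two, Nat.prime_three, by norm_num, by norm_num, by norm_num, ?_, ?_, ?_⟩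
  · rw [nextPrime_two]; exact h2
  · rw [nextPrime_three]; exact h3
  · rw [nextPrime_five]; exact h5

/-- The wall of `{2,3,5}` sits in the window of `7`: **`(log 7)/2 ≤ a*({2,3,5}) < (log 11)/2`** (the new rung below, theory-2's
kernel `UC(7)` above) — so `H(7)` («does `7` move the wall?») is exactly the next open sign. [this track; kernel wall certificates (tree)] -/
theorem wall_seven_mem_Ico :
    weilSemilocalThreshold (Nat.primesBelow 7) ∈ Ico (Real.log 7 / 2) (Real.log 11 / 2) :=
  ⟨log_seven_half_le_weilSemilocalThreshold, weilSemilocalThreshold_primesBelow_seven_lt⟩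

/-- **Two-sided KERNEL bracket of the third wall**: `(log 7)/2 ≤ a*({2,3,5}) ≤ 197/200`, i.e. `0 ≤ δ*(7) ≤ 197/200 − (log 7)/2 < 0.0121`
— the lower end is the new THEOREM rung, the upper end cc-s2-4's kernel wall certificate `weilSemilocalThreshold_twoThreeFive_le_0985`
(the sharper `393/400` of `SemilocalNegCertTwoThreeFive09825` is in the tree but not imported here; DATA a*({2,3,5}) ≈ 0.97422).
[cite: Yoshida1992HermitianForms, Prop. 6 (p. 320); kernel wall certificates (tree, cc-s2-4)] -/
theorem wall_seven_mem_Icc :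
    weilSemilocalThreshold (Nat.primesBelow 7) ∈ Icc (Real.log 7 / 2) (197 / 200) := by
  refine ⟨log_seven_half_le_weilSemilocalThreshold, ?_⟩
  have h := SemilocalPolyWitness.weilSemilocalThreshold_twoThreeFive_le_0985
  rw [HandoffUpperClauses.primesBelow_seven]
  push_cast at h
  exact h

/-- Offset form: **`0 ≤ δ*(7) ≤ 197/200 − (log 7)/2`** (`= 0.01204…`; the third window's wall offset is pinned in a kernel
interval of width `< 1/80`). [this track; kernel wall certificates (tree)] -/
theorem wallOffset_seven_mem_Icc : wallOffset 7 ∈ Icc (0 : ℝ) (197 / 200 - Real.log 7 / 2) := by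
  refine ⟨wallOffset_seven_nonneg, ?_⟩
  have h := wall_seven_mem_Icc.2
  unfold wallOffset
  push_cast
  linarith

/-! ## §4  Connes's `P(n)` and the content of Conjecture 4.1 at every `n ≤ 7` -/

/-- Weil positivity on the closed window `(log n)/2` for every `n ≤ 7` (all `≤ (log 7)/2 ≤ 1`). [tree rung] -/
theorem weilPositivityOn_log_half_of_le_seven (hn : n ≤ 7) : WeilPositivityOn (Real.log n / 2) := by
  refine weilPositivityOn_one.mono ?_
  rcases Nat.eq_zero_or_pos n with rfl | hn0
  · simp
  · have : Real.log n ≤ Real.log 7 :=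
      Real.log_le_log (by exact_mod_cast hn0) (by exact_mod_cast hn)
    linarith [log_seven_half_le_one]

/-- **Connes's property `P(n)` holds for every `n ≤ 7` (THEOREM)** — pole-free Weil tests `ĝ(0) = ĝ(1) = 0` supported in
`[−(log n)/2, (log n)/2]` have `Re Q(g) ≥ 0`; the tree had `n ≤ 5` (`ConnesPropertyPCriterion`, the `(log 5)/2` rung),
print has `n = 2`. [cite: Connes2026Letter, §4.1 (arXiv pp. 20–21) (P(n)); tree rung] -/
theorem weilPropertyP_of_le_seven (hn : n ≤ 7) : weilPropertyP n :=
  weilPropertyP_of_weilPositivityOn (weilPositivityOn_log_half_of_le_seven hn)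

/-- **The content of Connes–Consani's Conjecture 4.1 holds at every `q ≤ 7` (THEOREM)**: pole-free Weil tests supported
in the OPEN window `(−(log q)/2, (log q)/2)` have `Re Q(g) ≥ 0` (theory-1's XIV `cc41_of_le_five` moved one prime up; stated here without importing XIV).
[cite: ConnesConsani2021ScalingHamiltonian, Conj. 4.1 (arXiv:1910.14368 p. 18); tree rung] -/
theorem cc41_of_le_seven (hq : q ≤ 7) :
    ∀ g : ℝ → ℂ, IsWeilTest g → tsupport g ⊆ Ioo (-(Real.log q / 2)) (Real.log q / 2) →
      weilMellin g 0 = 0 → weilMellin g 1 = 0 → 0 ≤ (weilQuadratic g).re :=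
  fun g hg hsupp _ _ ↦ weilPositivityOn_log_half_of_le_seven hq g hg (hsupp.trans Ioo_subset_Icc_self)

/-- Conj. 4.1-content on the open window `(−1, 1)` itself (beyond `(log 7)/2`). [cite: ConnesConsani2021ScalingHamiltonian, Conj. 4.1 (arXiv:1910.14368 p. 18); tree rung] -/
theorem cc41_one :
    ∀ g : ℝ → ℂ, IsWeilTest g → tsupport g ⊆ Ioo (-1) 1 →
      weilMellin g 0 = 0 → weilMellin g 1 = 0 → 0 ≤ (weilQuadratic g).re :=
  fun g hg hsupp _ _ ↦ weilPositivityOn_one g hg (hsupp.trans Ioo_subset_Icc_self)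

/-! ## §5  The index ledger (file XIX) at the new rung -/

/-- **No negative even direction at bandwidth `1`**: the even negative index of Weil's form on `C(1)` is `0` at every
level. [cite: Bombieri2000Weil, §9, Thm 9 (p. 217) (index of the form on a window); tree rung] -/
theorem not_evenNegIndexAtLeast_succ_one (k : ℕ) : ¬ EvenNegIndexAtLeast (k + 1) 1 :=
  not_evenNegIndexAtLeast_succ_of_weilPositivityOn weilPositivityOn_one k

/-- No level at the window of `7`'s left end `(log 7)/2` (= XIX `not_evenNegIndexAtLeast_succ_of_handoffH` at `q = 5`; XIX not imported — pub-rhpf's lemma used directly). [this track] -/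
theorem not_evenNegIndexAtLeast_succ_log_seven_half (k : ℕ) :
    ¬ EvenNegIndexAtLeast (k + 1) (Real.log 7 / 2) :=
  not_evenNegIndexAtLeast_succ_of_weilPositivityOn weilPositivityOn_log_seven_half k

end Summit.RiemannHypothesis.RiemannHypothesis.Theorems.HandoffLadderRungOne

end
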